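import Mathlib.Analysis.SpecialFunctions.Arcosh
import Mathlib.Analysis.SpecialFunctions.Trigonometric.Complex
import Mathlib.Analysis.Complex.Exponential

/-!
# `BalabanUV.Beta.FP.ConstrainedBiLaplacianBloch1DRates` — road «FP» for binder row D1: RULING R-FP-29's S-sized [folklore] COMPANION of row
# **RHOA-4-GH (localisation half, fibre∕strip route)**, second half (owner d1-p3-g8, journal l.25917 (2); locator t4-ne9-formalise-leaf-08-g31,
# NOTE N-ne9leaf08g31-1 l.25910): «THE ZEROS OF THE TWO FIBRE NUMERATORS IN THE COMPLEX BLOCH MOMENTUM AND THE TWO RATES» —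
# `2 + cos θ = 0` iff `θ = (2m+1)π ± acosh(2)·i`; `33 + 26cos θ + cos 2θ = 0` iff `θ = (2m+1)π ± acosh((13∓√105)∕2)·i`; the zero-free strips;
# `acosh 2 = log(2+√3) ∈ ]1.3169, 1.3170[`, `acosh((13−√105)∕2) ∈ ]0.8426, 0.8427[`

HONEST DEPENDENCY (cell records, verbatim): «continuum YM on T⁴ ⇐ BetaPertH ∧ nine spine estimates (0/9 proved); BetaPertH ⇐ (D1) ∧ (D4) ∧
CAP+tail; G-an2-4 gates asym, D1 and NE2/3/4.»  HONEST FRAMING (cell contract, verbatim): «discharging `BetaPertH` makes Bałaban's UV stability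
UNCONDITIONAL — a real constructive-QFT result; it is NOT the continuum limit and NOT the Clay problem.»  THIS MODULE is [folklore] elementary
complex trigonometry (Mathlib `Complex.cos_eq_cos_iff`, `cos(π + a·i) = −cosh a`), `Real.arcosh` monotonicity, and KERNEL DECIMAL ENCLOSURES of
`cosh` at four rationals from Mathlib's `Real.exp_bound` (10 Taylor terms, remainder `|x|¹⁰·11∕(10!·10)`).  Mathlib only; no lattice, no operator,
no estimate of Bałaban's, no definition, no `def … : Prop`, nothing cited, 0 sorry.  It discharges NOTHING of `hbook`∕D1.  NOT RHOA-4-GH, NOT D1,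
NOT BetaPertH, NOT continuum, NOT Clay.

ABSOLUTE RULE (cell charter, verbatim): «No internally-minted statement may enter as a cited fact. Every hypothesis is either kernel-proved in this
package or a verbatim quotation of a PUBLISHED theorem with page reference. The manuscript(s) under audit are NOT citable for their own disputed
steps — they are the thing under adjudication; programme-internal (2001/route/tribunal) claims are never citable.»

THE ROW (R-FP-29 (2), verbatim): «the 1-D closed forms `S₄`∕`S₆` + the two `acosh` rates make a welcome S-sized [folklore] companion
(`FP/ConstrainedBiLaplacianBloch1D.lean`, exact trigonometric identities + `Real.arcosh`) for whoever wants it — not on the critical path».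
CONTEXT (N-ne9leaf08g31-1 (C) and R-FP-29 (2)(C), MODEL, DISPLAYED here, not proved): the numerators `2 + cos θ` of `S₄(θ) = (2+cos θ)∕(48sin⁴(θ∕2))`
and `33 + 26cos θ + cos 2θ` of `S₆(θ) = (33+26cos θ+cos 2θ)∕(3840sin⁶(θ∕2))` (real-line closed forms: sibling module
`FP/ConstrainedBiLaplacianBloch1D`, `hasSum_int_inv_sub_two_pi_mul_pow_four ∕ _six`) control the Bloch fibres of the block-mean-constrained inverse
Laplacian ∕ bi-Laplacian in the continuum-block limit; «rate(Laplacian) = acosh 2 = ln(2+√3) = 1.316958 per block (numerics 1.319 at n = 32)»,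
«nearest zero `cos θ* = (−13+√105)∕2 = −1.376525` ⟹ rate(bi-Laplacian) = acosh(1.376525) = 0.842633 per block (numerics 0.842 at n = 32)».
WHAT IS PROVED (all [folklore]):
* §3 ZEROS: `cos_pi_add_mul_I`; **`cos_eq_neg_iff`** — for real `y ≥ 1`, `cos θ = −y ↔ ∃ m ∈ ℤ, θ = (2m+1)π ± arcosh(y)·I`; `abs_im_eq_of_cos_eq_neg`
  (`|Im θ| = arcosh y` there); **`two_add_cos_eq_zero_iff`**; the ZERO-FREE STRIP **`two_add_cos_ne_zero_of_abs_im_lt`** (`|Im θ| < arcosh 2`);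
  **`numerator_six_factor`** `33 + 26cos θ + cos 2θ = 2(cos θ + (13−√105)∕2)(cos θ + (13+√105)∕2)`; **`numerator_six_eq_zero_iff`** (the two zero
  families `(2m+1)π ± arcosh((13∓√105)∕2)·I`); `arcosh_cPlus_le_arcosh_cMinus`; the ZERO-FREE STRIP **`numerator_six_ne_zero_of_abs_im_lt`**
  (`|Im θ| < arcosh((13−√105)∕2)`).  Both strips are sharp by the `iff`s.
* §4 RATES: **`arcosh_two_eq_log`** `arcosh 2 = log(2+√3)`; **`arcosh_cPlus_lt_arcosh_two`** (the bi-Laplacian strip is the narrower);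
  `lt_arcosh_iff_cosh_lt` ∕ `arcosh_lt_iff_lt_cosh`; the Taylor enclosure `abs_cosh_sub_taylor_le`; the four `cosh` comparisons; and the ENCLOSURES
  **`rate_laplacian_mem_Ioo`** `1.3169 < arcosh 2 < 1.3170`, **`rate_biLaplacian_mem_Ioo`** `0.8426 < arcosh((13−√105)∕2) < 0.8427`.
NOT HERE (honest): the alias sums themselves (sibling module); finite-n lattice symbols; d > 1; B-dependence; any (pp)∕(rem) letter; the loc half
`FP/ConstrainedBiLaplacianStrip`.  0∕4 row-D1 binders touched.  Provenance: NE9 formalisation swarm leaf seat `b2b-balaban-t4-ne9-formalise-leaf-04`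
gen 39 (cross-lane duty under typer rule 2 (a′); OFFER journal l.26047, 2026-08-21T03:12Z), 2026-08-21.
-/

noncomputable section

namespace Summit.QuantumFields.BalabanUV.Beta.FP.ConstrainedBiLaplacianBloch1DRates

open Real

/-! ## §3 Zeros of the two numerators in the complex Bloch momentum -/

section Zeros

open Complex

/-- [folklore] `cos(π + a·I) = −cosh a` for real `a`. -/
theorem cos_pi_add_mul_I (a : ℝ) : Complex.cos (π + a * I) = -((Real.cosh a : ℝ) : ℂ) := by
  rw [Complex.cos_add, Complex.cos_pi, Complex.sin_pi, Complex.cos_mul_I, Complex.ofReal_cosh]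
  ring

/-- [folklore] **Where `cos` takes a real value `≤ −1`.** For real `y ≥ 1` and complex `θ`:
`cos θ = −y ↔ ∃ m ∈ ℤ, θ = (2m+1)π + arcosh(y)·I ∨ θ = (2m+1)π − arcosh(y)·I`. -/
theorem cos_eq_neg_iff {θ : ℂ} {y : ℝ} (hy : 1 ≤ y) :
    Complex.cos θ = -(y : ℂ) ↔
      ∃ m : ℤ, θ = (2 * m + 1) * π + Real.arcosh y * I ∨ θ = (2 * m + 1) * π - Real.arcosh y * I := by
  have hw : Complex.cos (π + Real.arcosh y * I) = -(y : ℂ) := by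
    rw [cos_pi_add_mul_I, Real.cosh_arcosh hy]
  rw [← hw, Complex.cos_eq_cos_iff]
  constructor
  · rintro ⟨k, hk | hk⟩
    · refine ⟨-k, Or.inl ?_⟩
      push_cast
      linear_combination (-1 : ℂ) * hk
    · refine ⟨k - 1, Or.inr ?_⟩
      push_cast
      linear_combination hk
  · rintro ⟨m, hm | hm⟩
    · refine ⟨-m, Or.inl ?_⟩
      push_cast
      linear_combination (-1 : ℂ) * hm
    · refine ⟨m + 1, Or.inr ?_⟩
      push_cast
      linear_combination hm

/-- [folklore] At such a point `|Im θ| = arcosh y`. -/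
theorem abs_im_eq_of_cos_eq_neg {θ : ℂ} {y : ℝ} (hy : 1 ≤ y) (h : Complex.cos θ = -(y : ℂ)) :
    |θ.im| = Real.arcosh y := by
  have ha := Real.arcosh_nonneg hy
  obtain ⟨m, hm | hm⟩ := (cos_eq_neg_iff hy).1 h
  · rw [hm]
    simp [abs_of_nonneg ha]
  · rw [hm]
    simp [abs_of_nonneg ha]

/-- [folklore] **THE ZEROS OF `2 + cos θ`** (the numerator of the s = 1 fibre functional ∕ of `S₄`): exactly the points
`(2m+1)π ± arcosh(2)·I`, `m ∈ ℤ`. -/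
theorem two_add_cos_eq_zero_iff (θ : ℂ) :
    2 + Complex.cos θ = 0 ↔
      ∃ m : ℤ, θ = (2 * m + 1) * π + Real.arcosh 2 * I ∨ θ = (2 * m + 1) * π - Real.arcosh 2 * I := by
  have h := cos_eq_neg_iff (θ := θ) (y := 2) (by norm_num)
  push_cast at h
  rw [← h]
  constructor
  · intro h1; linear_combination h1
  · intro h1; linear_combination h1

/-- [folklore] **THE ZERO-FREE STRIP OF `2 + cos θ`**: `|Im θ| < arcosh 2 ⟹ 2 + cos θ ≠ 0` (sharp, by `two_add_cos_eq_zero_iff`). -/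
theorem two_add_cos_ne_zero_of_abs_im_lt {θ : ℂ} (h : |θ.im| < Real.arcosh 2) : 2 + Complex.cos θ ≠ 0 := by
  intro h0
  have h1 : Complex.cos θ = -((2 : ℝ) : ℂ) := by
    push_cast
    linear_combination h0
  have h2 := abs_im_eq_of_cos_eq_neg (by norm_num) h1
  linarith

/-- [folklore] `√105 ≤ 11`, hence `1 ≤ (13 − √105)/2`. -/
theorem one_le_cPlus : (1 : ℝ) ≤ (13 - Real.sqrt 105) / 2 := by
  nlinarith [Real.sq_sqrt (show (0 : ℝ) ≤ 105 by norm_num), Real.sqrt_nonneg 105]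

/-- [folklore] `1 ≤ (13 + √105)/2`. -/
theorem one_le_cMinus : (1 : ℝ) ≤ (13 + Real.sqrt 105) / 2 := by
  nlinarith [Real.sqrt_nonneg 105]

/-- [folklore] **THE FACTORISATION OF THE s = 2 NUMERATOR**: `33 + 26 cos θ + cos 2θ = 2 (cos θ + (13−√105)/2)(cos θ + (13+√105)/2)`
(over `ℂ`; i.e. `2(cos θ − c₊)(cos θ − c₋)` with `c± = (−13 ± √105)/2`). -/
theorem numerator_six_factor (θ : ℂ) :
    33 + 26 * Complex.cos θ + Complex.cos (2 * θ) =
      2 * (Complex.cos θ + (((13 - Real.sqrt 105) / 2 : ℝ) : ℂ)) * (Complex.cos θ + (((13 + Real.sqrt 105) / 2 : ℝ) : ℂ)) := by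
  have hs : ((Real.sqrt 105 : ℝ) : ℂ) ^ 2 = 105 := by
    rw [← Complex.ofReal_pow, Real.sq_sqrt (by norm_num : (0 : ℝ) ≤ 105)]
    push_cast
    ring
  rw [Complex.cos_two_mul]
  push_cast
  linear_combination (1 / 2 : ℂ) * hs

/-- [folklore] **THE ZEROS OF `33 + 26 cos θ + cos 2θ`** (the numerator of the s = 2 fibre functional ∕ of `S₆`): exactly the points
`(2m+1)π ± arcosh((13−√105)/2)·I` and `(2m+1)π ± arcosh((13+√105)/2)·I`, `m ∈ ℤ`. -/
theorem numerator_six_eq_zero_iff (θ : ℂ) :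
    33 + 26 * Complex.cos θ + Complex.cos (2 * θ) = 0 ↔
      (∃ m : ℤ, θ = (2 * m + 1) * π + Real.arcosh ((13 - Real.sqrt 105) / 2) * I ∨
          θ = (2 * m + 1) * π - Real.arcosh ((13 - Real.sqrt 105) / 2) * I) ∨
        (∃ m : ℤ, θ = (2 * m + 1) * π + Real.arcosh ((13 + Real.sqrt 105) / 2) * I ∨
          θ = (2 * m + 1) * π - Real.arcosh ((13 + Real.sqrt 105) / 2) * I) := by
  rw [numerator_six_factor, mul_eq_zero, mul_eq_zero, ← cos_eq_neg_iff one_le_cPlus, ← cos_eq_neg_iff one_le_cMinus]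
  have h2 : (2 : ℂ) ≠ 0 := two_ne_zero
  simp only [h2, false_or]
  constructor
  · rintro (h | h)
    · exact Or.inl (by linear_combination h)
    · exact Or.inr (by linear_combination h)
  · rintro (h | h)
    · exact Or.inl (by linear_combination h)
    · exact Or.inr (by linear_combination h)

/-- [folklore] `arcosh((13−√105)/2) ≤ arcosh((13+√105)/2)`: of the two zero families, the `c₊` family is the one nearer to the real axis. -/
theorem arcosh_cPlus_le_arcosh_cMinus :
    Real.arcosh ((13 - Real.sqrt 105) / 2) ≤ Real.arcosh ((13 + Real.sqrt 105) / 2) := by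
  rw [Real.arcosh_le_arcosh (by linarith [one_le_cPlus]) (by linarith [one_le_cMinus])]
  linarith [Real.sqrt_nonneg 105]

/-- [folklore] **THE ZERO-FREE STRIP OF `33 + 26 cos θ + cos 2θ`**: `|Im θ| < arcosh((13−√105)/2) ⟹ 33 + 26cos θ + cos 2θ ≠ 0`
(sharp, by `numerator_six_eq_zero_iff`). -/
theorem numerator_six_ne_zero_of_abs_im_lt {θ : ℂ} (h : |θ.im| < Real.arcosh ((13 - Real.sqrt 105) / 2)) :
    33 + 26 * Complex.cos θ + Complex.cos (2 * θ) ≠ 0 := by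
  intro h0
  rw [numerator_six_factor, mul_eq_zero, mul_eq_zero] at h0
  rcases h0 with (h0 | h0) | h0
  · exact two_ne_zero h0
  · have h1 : Complex.cos θ = -((((13 - Real.sqrt 105) / 2 : ℝ)) : ℂ) := by linear_combination h0
    have h2 := abs_im_eq_of_cos_eq_neg one_le_cPlus h1
    linarith
  · have h1 : Complex.cos θ = -((((13 + Real.sqrt 105) / 2 : ℝ)) : ℂ) := by linear_combination h0
    have h2 := abs_im_eq_of_cos_eq_neg one_le_cMinus h1
    have h3 := arcosh_cPlus_le_arcosh_cMinus
    linarith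

end Zeros

/-! ## §4 The two rates: `arcosh 2 = log(2 + √3)` and `arcosh((13 − √105)/2)`, with kernel enclosures -/

/-- [folklore] The Laplacian rate in closed form: `arcosh 2 = log(2 + √3)`. -/
theorem arcosh_two_eq_log : Real.arcosh 2 = Real.log (2 + Real.sqrt 3) := by
  rw [Real.arcosh]
  norm_num

/-- [folklore] The bi-Laplacian strip is the narrower one: `arcosh((13 − √105)/2) < arcosh 2`. -/
theorem arcosh_cPlus_lt_arcosh_two : Real.arcosh ((13 - Real.sqrt 105) / 2) < Real.arcosh 2 := by
  rw [Real.arcosh_lt_arcosh (by linarith [one_le_cPlus]) (by norm_num)]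
  nlinarith [Real.sq_sqrt (show (0 : ℝ) ≤ 105 by norm_num), Real.sqrt_nonneg 105]

/-- [folklore] `a < arcosh y ↔ cosh a < y` for `0 ≤ a`, `1 ≤ y`. -/
theorem lt_arcosh_iff_cosh_lt {a y : ℝ} (ha : 0 ≤ a) (hy : 1 ≤ y) : a < Real.arcosh y ↔ Real.cosh a < y := by
  conv_rhs => rw [← Real.cosh_arcosh hy]
  rw [Real.cosh_lt_cosh, abs_of_nonneg ha, abs_of_nonneg (Real.arcosh_nonneg hy)]

/-- [folklore] `arcosh y < a ↔ y < cosh a` for `0 ≤ a`, `1 ≤ y`. -/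
theorem arcosh_lt_iff_lt_cosh {a y : ℝ} (ha : 0 ≤ a) (hy : 1 ≤ y) : Real.arcosh y < a ↔ y < Real.cosh a := by
  conv_rhs => rw [← Real.cosh_arcosh hy]
  rw [Real.cosh_lt_cosh, abs_of_nonneg ha, abs_of_nonneg (Real.arcosh_nonneg hy)]

/-- [folklore] Two-sided Taylor enclosure of `cosh` on `[−1, 1]` (from Mathlib's `Real.exp_bound` at `x` and `−x`). -/
theorem abs_cosh_sub_taylor_le {x : ℝ} (hx : |x| ≤ 1) {n : ℕ} (hn : 0 < n) :
    |Real.cosh x - (∑ m ∈ Finset.range n, (x ^ m / m.factorial + (-x) ^ m / m.factorial)) / 2| ≤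
      |x| ^ n * ((n.succ : ℝ) / (n.factorial * n)) := by
  have h1 := Real.exp_bound hx hn
  have hx' : |(-x)| ≤ 1 := by rwa [abs_neg]
  have h2 := Real.exp_bound hx' hn
  rw [abs_neg] at h2
  rw [Real.cosh_eq, Finset.sum_add_distrib]
  have e : (Real.exp x + Real.exp (-x)) / 2 -
      ((∑ m ∈ Finset.range n, x ^ m / m.factorial) + ∑ m ∈ Finset.range n, (-x) ^ m / m.factorial) / 2 =
      ((Real.exp x - ∑ m ∈ Finset.range n, x ^ m / m.factorial) +
        (Real.exp (-x) - ∑ m ∈ Finset.range n, (-x) ^ m / m.factorial)) / 2 := by ring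
  rw [e, abs_div, abs_two]
  have h3 := abs_add_le (Real.exp x - ∑ m ∈ Finset.range n, x ^ m / m.factorial)
    (Real.exp (-x) - ∑ m ∈ Finset.range n, (-x) ^ m / m.factorial)
  linarith

/-- [folklore] `cosh(2a) = 2cosh²(a) − 1`. -/
theorem cosh_two_mul_eq (a : ℝ) : Real.cosh (2 * a) = 2 * Real.cosh a ^ 2 - 1 := by
  rw [Real.cosh_two_mul, Real.sinh_sq]
  ring

/-- [folklore] Upper Taylor bound for `cosh(0.8426)`. -/
theorem cosh_0_8426_lt : Real.cosh (8426 / 10000) < (13 - Real.sqrt 105) / 2 := by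
  have hb := abs_cosh_sub_taylor_le (x := 8426 / 10000) (by norm_num) (n := 10) (by norm_num)
  norm_num [Finset.sum_range_succ, Nat.factorial] at hb
  have hb' := (abs_sub_le_iff.1 hb).1
  rw [lt_div_iff₀ (by norm_num : (0 : ℝ) < 2), lt_sub_comm, Real.sqrt_lt' (by linarith)]
  nlinarith

/-- [folklore] Lower Taylor bound for `cosh(0.8427)`. -/
theorem lt_cosh_0_8427 : (13 - Real.sqrt 105) / 2 < Real.cosh (8427 / 10000) := by
  have hb := abs_cosh_sub_taylor_le (x := 8427 / 10000) (by norm_num) (n := 10) (by norm_num)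
  norm_num [Finset.sum_range_succ, Nat.factorial] at hb
  have hb1 := (abs_sub_le_iff.1 hb).1
  have hb2 := (abs_sub_le_iff.1 hb).2
  rw [div_lt_iff₀ (by norm_num : (0 : ℝ) < 2), sub_lt_comm, Real.lt_sqrt (by linarith)]
  nlinarith

/-- [folklore] **THE BI-LAPLACIAN RATE, ENCLOSED**: `0.8426 < arcosh((13 − √105)/2) < 0.8427` (N-ne9leaf08g31-1 (C): `0.842633`; the toy's bulk
rate per block at n = 32 is 0.842 — numerics DISPLAYED, not asserted). -/
theorem rate_biLaplacian_mem_Ioo :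
    0.8426 < Real.arcosh ((13 - Real.sqrt 105) / 2) ∧ Real.arcosh ((13 - Real.sqrt 105) / 2) < 0.8427 := by
  constructor
  · rw [lt_arcosh_iff_cosh_lt (by norm_num) one_le_cPlus, show (0.8426 : ℝ) = 8426 / 10000 by norm_num]
    exact cosh_0_8426_lt
  · rw [arcosh_lt_iff_lt_cosh (by norm_num) one_le_cPlus, show (0.8427 : ℝ) = 8427 / 10000 by norm_num]
    exact lt_cosh_0_8427

/-- [folklore] Upper bound `cosh(1.3169) < 2` via `cosh(2a) = 2cosh²a − 1` and the Taylor enclosure at `a = 0.65845`. -/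
theorem cosh_1_3169_lt_two : Real.cosh (13169 / 10000) < 2 := by
  have hb := abs_cosh_sub_taylor_le (x := 13169 / 20000) (by norm_num) (n := 10) (by norm_num)
  norm_num [Finset.sum_range_succ, Nat.factorial] at hb
  have hb1 := (abs_sub_le_iff.1 hb).1
  have e : (13169 / 10000 : ℝ) = 2 * (13169 / 20000) := by norm_num
  rw [e, cosh_two_mul_eq]
  have h0 : 0 ≤ Real.cosh (13169 / 20000) := (Real.cosh_pos _).le
  nlinarith

/-- [folklore] Lower bound `2 < cosh(1.3170)`. -/
theorem two_lt_cosh_1_3170 : 2 < Real.cosh (13170 / 10000) := by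
  have hb := abs_cosh_sub_taylor_le (x := 6585 / 10000) (by norm_num) (n := 10) (by norm_num)
  norm_num [Finset.sum_range_succ, Nat.factorial] at hb
  have hb2 := (abs_sub_le_iff.1 hb).2
  have e : (13170 / 10000 : ℝ) = 2 * (6585 / 10000) := by norm_num
  rw [e, cosh_two_mul_eq]
  have h0 : 0 ≤ Real.cosh (6585 / 10000) := (Real.cosh_pos _).le
  nlinarith

/-- [folklore] **THE LAPLACIAN RATE, ENCLOSED**: `1.3169 < arcosh 2 < 1.3170` (`arcosh 2 = log(2+√3) = 1.316958`; the toy's Laplacian control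
rate at n = 32 is 1.319 — numerics DISPLAYED, not asserted). -/
theorem rate_laplacian_mem_Ioo : 1.3169 < Real.arcosh 2 ∧ Real.arcosh 2 < 1.3170 := by
  constructor
  · rw [lt_arcosh_iff_cosh_lt (by norm_num) (by norm_num), show (1.3169 : ℝ) = 13169 / 10000 by norm_num]
    exact cosh_1_3169_lt_two
  · rw [arcosh_lt_iff_lt_cosh (by norm_num) (by norm_num), show (1.3170 : ℝ) = 13170 / 10000 by norm_num]
    exact two_lt_cosh_1_3170

end Summit.QuantumFields.BalabanUV.Beta.FP.ConstrainedBiLaplacianBloch1DRates
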